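import Summits.FinalStateConjecture.FinalStateConjecture.Theorems.SeamedChartsExhaust.Negative.ExactSchwarzschildClauses

/-!
# Non-vacuity with a hole; the `∩ O` of FRONTIER and the relativisation of `HonestCore` (c) are load-bearing
# (negative-side support for crux `stmt-FinalStateConjecture-13551`, route `StarvedNecks`; cycle 2, part 4/4)

Three consequences of the exact Schwarzschild model (`ExactSchwarzschildModel`/`…Clauses`), with the
route's let-bound predicates `Hc` (`HonestCore`) and `Sm` (`SEAMED`) inlined verbatim:

* `exists_N_one_honest_seamed_exhaustive` — the `O`-shape `O = J⁺(univ) ∩ I⁻(d.charted)`, `Hc`, `Sm` and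
  the conclusion `HasExhaustiveCharts d` hold simultaneously for a decomposition with ONE hole (the first
  hole-bearing witness of the clause set of `SeamedChartsExhaust`; exterior patch `r₀ = 2M`, mass `1`).
* `not_frontierBelowSlab_absolute` — the frontier statement of the crux's picked line,
  `(closure (certifiedLate d R τ₁) ∩ O) \ certifiedLate d R τ₁ ⊆ J⁻(certifiedSlab d R τ₁)`
  (`stub_frontierBelowSlab`), becomes FALSE when the intersection with `O` is dropped: on the
  horizon-penetrating patch `{r > 1}` the future-horizon point `z = (2, 2, 0, 0)` (`SchwModel.zH`) is the
  limit of the certified tube points `wₙ = (2, 2 + 1/(n+1), 0, 0)`, is not charted (`r(z) = 2M`), and is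
  not in `J⁻` of the certified slab at chart time `1`, which lies in `{x⁰ = 1}` (time function).
* `not_absolute_tubeClosedness` — clause (c) of `HonestCore` ("late tube portions are relatively closed in
  `O`") cannot be strengthened to "closed": that variant contradicts `Hc` itself in the same model.

References: M. Dafermos, I. Rodnianski, *Lectures on black holes and linear waves*, arXiv:0811.0354, §5.1
(Schwarzschild/Kerr in ingoing Kerr–Schild coordinates, `∇t*` timelike); R. P. Kerr, A. Schild (1965), §3;
B. O'Neill, *Semi-Riemannian geometry*, Academic Press 1983, Ch. 14, pp. 402–403; M. Dafermos,
G. Holzegel, I. Rodnianski, M. Taylor, arXiv:2104.08222, §1.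
-/

noncomputable section

open TopologicalSpace Manifold Filter Topology Set Function
open scoped ContDiff Topology ENNReal Manifold

-- instance search through nested operator types `E4 →L E4 →L E4 →L ℝ` (as in the tree files)
set_option maxSynthPendingDepth 3

namespace Summit.FinalStateConjecture.FinalStateConjecture.Theorems.SeamedChartsExhaust.Negative

open Literature.Geometry.Lorentzian LorentzianMetric

namespace SchwModel

variable (P : Params)

/-! ### The horizon point (horizon-penetrating patch, `r₀ < 2M`) -/

/-- The points `(2, c, 0, 0)`: time `2`, radius `|c|`. -/
def zc (c : ℝ) : E4 := E4.ofTimeSpace 2 (c • EuclideanSpace.single (0 : Fin 3) (1 : ℝ))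

/-- `(zc c)⁰ = 2`. [folklore] -/
theorem zc_apply_zero (c : ℝ) : zc c 0 = 2 := E4.ofTimeSpace_apply_zero _ _

/-- `r(zc c) = |c|`. [folklore] -/
theorem radius_zc (c : ℝ) : Kerr.radius 0 (zc c) = |c| := by
  rw [Kerr.radius_zero_left, zc, E4.spatialNorm_ofTimeSpace, norm_smul, Real.norm_eq_abs]
  simp

/-- `zc` is continuous. [folklore] -/
theorem continuous_zc : Continuous zc :=
  (E4.continuous_ofTimeSpace 2).comp (continuous_id.smul continuous_const)

/-- The horizon point `z = (2, 2M, 0, 0)` of the patch (it exists iff `r₀ < 2M`). -/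
def zH (hr₀ : P.r₀ < 2 * P.M) : (ST P).carrier :=
  ⟨zc (2 * P.M), by
    show max P.r₀ 0 < Kerr.radius 0 (zc (2 * P.M))
    rw [radius_zc, abs_of_pos P.two_M_pos, P.max_r₀]
    exact hr₀⟩

/-- `x⁰(z) = 2`. [folklore] -/
theorem zH_zero (hr₀ : P.r₀ < 2 * P.M) : (zH P hr₀).1 0 = 2 := zc_apply_zero _

/-- `r(z) = 2M`: `z` is on the event horizon. [folklore] -/
theorem radius_zH (hr₀ : P.r₀ < 2 * P.M) : Kerr.radius 0 (zH P hr₀).1 = 2 * P.M := by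
  show Kerr.radius 0 (zc (2 * P.M)) = _
  rw [radius_zc, abs_of_pos P.two_M_pos]

/-- `0 < 2M + 1/(n+1)`. [folklore] -/
theorem wc_pos (n : ℕ) : 0 < 2 * P.M + 1 / ((n : ℝ) + 1) := by
  have h1 := P.two_M_pos
  have h2 : (0 : ℝ) < 1 / ((n : ℝ) + 1) := by positivity
  linarith

/-- The approximating exterior points `wₙ = (2, 2M + 1/(n+1), 0, 0)`. -/
def wn (n : ℕ) : (ST P).carrier :=
  ⟨zc (2 * P.M + 1 / ((n : ℝ) + 1)), by
    show max P.r₀ 0 < Kerr.radius 0 (zc _)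
    rw [radius_zc, P.max_r₀, abs_of_pos (wc_pos P n)]
    have : (0 : ℝ) < 1 / ((n : ℝ) + 1) := by positivity
    linarith [P.hr₂]⟩

/-- `r(wₙ) = 2M + 1/(n+1)`. [folklore] -/
theorem radius_wn (n : ℕ) : Kerr.radius 0 (wn P n).1 = 2 * P.M + 1 / ((n : ℝ) + 1) := by
  show Kerr.radius 0 (zc _) = _
  rw [radius_zc, abs_of_pos (wc_pos P n)]

/-- `x⁰(wₙ) = 2`. [folklore] -/
theorem wn_zero (n : ℕ) : (wn P n).1 0 = 2 := zc_apply_zero _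

/-- `wₙ` is an exterior point. [folklore] -/
theorem wn_mem_O (n : ℕ) : wn P n ∈ O P := by
  rw [mem_O, radius_wn]
  have : (0 : ℝ) < 1 / ((n : ℝ) + 1) := by positivity
  linarith

/-- `r(wₙ) ≤ Rc 2`: `wₙ` is a certified tube point at hole time `2`. [folklore] -/
theorem radius_wn_le (n : ℕ) : Kerr.radius 0 (wn P n).1 ≤ Rc P 2 := by
  rw [radius_wn, Rc]
  have h1 : (1 : ℝ) / ((n : ℝ) + 1) ≤ 1 := by
    rw [div_le_one (by positivity)]; linarith [n.cast_nonneg (α := ℝ)]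
  linarith [P.two_M_lt_R₀, Real.sqrt_nonneg (2 : ℝ)]

/-- `wₙ → z`. [folklore] -/
theorem tendsto_wn (hr₀ : P.r₀ < 2 * P.M) : Tendsto (wn P) atTop (𝓝 (zH P hr₀)) := by
  refine ((Topology.IsEmbedding.subtypeVal
    (p := fun x : E4 ↦ x ∈ (Kerr.region (0 : ℝ) P.r₀ : Set E4))).tendsto_nhds_iff).mpr ?_
  show Tendsto (fun n : ℕ ↦ zc (2 * P.M + 1 / ((n : ℝ) + 1))) atTop (𝓝 (zc (2 * P.M)))
  have h : Tendsto (fun n : ℕ ↦ 2 * P.M + 1 / ((n : ℝ) + 1)) atTop (𝓝 (2 * P.M)) := by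
    have h1 : Tendsto (fun n : ℕ ↦ (1 : ℝ) / ((n : ℝ) + 1)) atTop (𝓝 0) :=
      tendsto_one_div_add_atTop_nhds_zero_nat
    simpa using (tendsto_const_nhds (x := 2 * P.M)).add h1
  exact (continuous_zc.tendsto _).comp h

/-- The horizon point lies in the closure of the hole-chart image of any coordinate set containing
the points `(2, 2M + 1/(n+1), 0, 0)`. -/
theorem zH_mem_closure_image (hr₀ : P.r₀ < 2 * P.M) {S : Set (boostedKerrBackground 1 0 P.M 0).domain}
    (hS : ∀ n, (⟨(wn P n).1, (mem_bext_iff P).mpr (wn_mem_O P n)⟩ :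
      (boostedKerrBackground 1 0 P.M 0).domain) ∈ S) :
    zH P hr₀ ∈ closure (Ψ P '' S) := by
  refine mem_closure_of_tendsto (tendsto_wn P hr₀) (Eventually.of_forall fun n ↦ ?_)
  exact ⟨_, hS n, Subtype.ext rfl⟩

/-- The horizon point is not charted: every charted point has `r > 2M`. -/
theorem zH_not_mem_image_Ψ (hr₀ : P.r₀ < 2 * P.M) (S : Set (boostedKerrBackground 1 0 P.M 0).domain) :
    zH P hr₀ ∉ Ψ P '' S := by
  rintro ⟨x, -, hx⟩
  have h := Ψ_mem_O P x
  rw [hx, mem_O, radius_zH] at h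
  exact lt_irrefl _ h

/-- The horizon point is not flat-charted. [folklore] -/
theorem zH_not_mem_image_Φ (hr₀ : P.r₀ < 2 * P.M) (S : Set (Minkowski.backgroundOn (U P)).domain) :
    zH P hr₀ ∉ Φ P '' S := by
  rintro ⟨y, -, hy⟩
  have h := Φ_mem_O P y
  rw [hy, mem_O, radius_zH] at h
  exact lt_irrefl _ h

/-- The horizon point `(2, 2M, 0, 0)` is in the closure of the certified late region after chart
time `1` but not in it. -/
theorem zH_mem_closure_diff (hr₀ : P.r₀ < 2 * P.M) :
    zH P hr₀ ∈ closure (certifiedLate (decomp P) (fun _ ↦ Rc P) 1) \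
      certifiedLate (decomp P) (fun _ ↦ Rc P) 1 := by
  constructor
  · refine closure_mono (subset_union_right.trans' (subset_iUnion _ default)) ?_
    refine zH_mem_closure_image P hr₀ fun n ↦ ⟨?_, ?_⟩
    · show (1 : ℝ) < (boostedKerrBackground 1 0 P.M 0).time (wn P n).1
      rw [bg_time, wn_zero]; norm_num
    · show (boostedKerrBackground 1 0 P.M 0).radius (wn P n).1 ≤
        Rc P ((boostedKerrBackground 1 0 P.M 0).time (wn P n).1)
      rw [bg_radius, bg_time, wn_zero]
      exact radius_wn_le P n
  · rintro (h | h)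
    · exact zH_not_mem_image_Φ P hr₀ _ h
    · obtain ⟨i, hi⟩ := mem_iUnion.mp h
      exact zH_not_mem_image_Ψ P hr₀ _ hi

/-- The horizon point is NOT causally below the certified slab at chart time `1`: that slab lies in
`{x⁰ = 1}` and Kerr–Schild time is a time function. -/
theorem zH_not_mem_causalPast_slab (hr₀ : P.r₀ < 2 * P.M) :
    zH P hr₀ ∉ (ST P).metric.causalPast (ST P).timeOrientation
      (certifiedSlab (decomp P) (fun _ ↦ Rc P) 1) := by
  intro h
  obtain ⟨q, hq, hle⟩ := KerrTime.time_le_of_mem_causalPast h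
  rw [zH_zero] at hle
  have hq1 : q.1 0 = 1 := by
    rcases hq with ⟨y, hy, rfl⟩ | hq
    · exact hy
    · obtain ⟨i, x, hx, rfl⟩ := mem_iUnion.mp hq
      have h1 : (boostedKerrBackground 1 0 P.M 0).time x.1 = 1 := hx.1
      rwa [bg_time] at h1
  linarith


end SchwModel

/-! ### Results: non-vacuity with a hole, and two absolute (un-relativised) variants refuted -/

open scoped SchwModel

/-- Order-zero Kerr–Schild tail: for every `M` there is `R₁` with `‖g_{M,0} − η‖ ≤ 1/10` on
`{r ≥ R₁}` (the order-`0` case of the decay of all derivatives, `Kerr.norm_iteratedFDeriv_ksPert_le`).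
Kerr–Schild 1965, §3. [folklore] -/
theorem exists_tail_tenth (M : ℝ) :
    ∃ R₁ : ℝ, 0 < R₁ ∧ ∀ x : E4, R₁ ≤ Kerr.radius 0 x → ‖Kerr.bilin M 0 x - Minkowski.bilin‖ ≤ 10⁻¹ := by
  obtain ⟨C, R, hR, h⟩ := Kerr.norm_iteratedFDeriv_ksPert_le M 0 0
  refine ⟨max R (10 * |C| + 1), lt_max_of_lt_left hR, fun x hx ↦ ?_⟩
  have hRx : R ≤ Kerr.radius 0 x := (le_max_left _ _).trans hx
  have hCx : 10 * |C| + 1 ≤ Kerr.radius 0 x := (le_max_right _ _).trans hx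
  have hr : 0 < Kerr.radius 0 x := hR.trans_le hRx
  have h1 := h x hRx
  rw [norm_iteratedFDeriv_zero] at h1
  calc ‖Kerr.bilin M 0 x - Minkowski.bilin‖ ≤ C / Kerr.radius 0 x := h1
    _ ≤ |C| / Kerr.radius 0 x := div_le_div_of_nonneg_right (le_abs_self C) hr.le
    _ ≤ 10⁻¹ := by
      rw [div_le_iff₀ hr]
      nlinarith [abs_nonneg C]

/-- Model parameters with the tail bound built in: mass `1`, prescribed inner radius `0 < r₀ ≤ 2`, and
`R₀ = max 100 R₁`. [folklore] -/
theorem exists_params (r₀ : ℝ) (hr₀ : 0 < r₀) (hr₂ : r₀ ≤ 2) :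
    ∃ P : SchwModel.Params, P.M = 1 ∧ P.r₀ = r₀ ∧
      ∀ x : E4, P.R₀ ≤ Kerr.radius 0 x → ‖Kerr.bilin P.M 0 x - Minkowski.bilin‖ ≤ 10⁻¹ := by
  obtain ⟨R₁, hR₁, htail⟩ := exists_tail_tenth 1
  refine ⟨⟨1, r₀, max 100 R₁, one_pos, hr₀, by linarith, ?_⟩, rfl, rfl, fun x hx ↦ htail x ?_⟩
  · linarith [le_max_left (100 : ℝ) R₁]
  · exact (le_max_right _ _).trans hx

/-- **NON-VACUITY WITH A HOLE (`N = 1`).** The hypotheses of `StarvedNecks.SeamedChartsExhaust` at the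
level of one spacetime — the `O`-shape `O = J⁺(Σ) ∩ I⁻(d.charted)` (`Σ = univ`), `HonestCore` (the
let-bound `Hc`, verbatim) and all twelve clauses of `SEAMED` (the let-bound `Sm`, verbatim) — hold
simultaneously, TOGETHER WITH the conclusion `HasExhaustiveCharts d`, for a decomposition with ONE hole:
exact Schwarzschild of mass `1` in ingoing Kerr–Schild coordinates on the exterior patch `{r > 2}`,
identity hole chart, identity flat chart on `{x⁰ > −1, r > R₀ + 1 + √x⁰}`, `R(s) = R₀ + 4 + √s`.
Dafermos–Rodnianski arXiv:0811.0354, §5.1. [folklore] -/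
theorem exists_N_one_honest_seamed_exhaustive :
    let Hc := ( fun (𝓢 : Spacetime.{0} 4) (O : Set 𝓢.carrier) (k : ℕ) (d : FinalStateDecomposition 𝓢 O k) (R₀ : ℝ) => let B := d.background; let t := fun i ↦ (B i).time; let r := fun i ↦ (B i).radius; let Ψ := d.chart; (∀ i, Kerr.IsSubextremal (d.mass i) (d.spin i) ∧ 100 * d.mass i ≤ R₀ ∧ 0 < ((d.motion i).1 : E4 ≃L[ℝ] E4) (E4.basisVector 0) 0) ∧ (∀ i (ϱ τ₂ : ℝ), R₀ ≤ ϱ → d.τ₀ < τ₂ → Ψ i '' {x | d.τ₀ < t i x.1 ∧ t i x.1 < τ₂ ∧ r i x.1 < ϱ} ⊆ 𝓢.metric.causalPast 𝓢.timeOrientation (Ψ i '' (B i).truncTimeSlab ϱ τ₂)) ∧ (∀ i (τ' : ℝ) (ϱ : ℝ → ℝ), Continuous ϱ → d.τ₀ < τ' → let A := Ψ i '' {x | τ' ≤ t i x.1 ∧ r i x.1 ≤ ϱ (t i x.1)}; closure A ∩ O ⊆ A) ∧ (∀ y : d.flatDomain, d.τ₀ < y.1 0 → 𝓢.timeOrientation.IsFutureDirected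 (mfderiv 𝓘(ℝ, E4) (𝓡 4) d.flatChart y (E4.basisVector 0))) )
    let Sm := ( fun (𝓢 : Spacetime.{0} 4) (O : Set 𝓢.carrier) (d : FinalStateDecomposition 𝓢 O 2) (R : Fin d.N → ℝ → ℝ) (R₀ : ℝ) => let B := d.background; let t := fun i ↦ (B i).time; let r := fun i ↦ (B i).radius; let Λ := fun i ↦ ((d.motion i).1 : E4 ≃L[ℝ] E4); let Φ := d.flatChart; let Ψ := d.chart; let ρ := d.excision; (∀ i, Monotone (R i) ∧ Continuous (R i) ∧ ∀ s, R₀ + 4 ≤ R i s ∧ R₀ ≤ ρ i s) ∧ (∀ i, Tendsto (fun τ ↦ 𝓢.truncDeviationCk (B i) (Ψ i) 2 (R i τ) τ) atTop (𝓝 0)) ∧ supCkENorm (Subtype.val '' {y : d.flatDomain | d.τ₀ ≤ y.1 0}) 0 (𝓢.deviationExtend (Minkowski.backgroundOn d.flatDomain) Φ) ≤ 10⁻¹ ∧ (∀ i, supCkENorm (Subtype.val '' {x : (B i).domain | (d.τ₀ ≤ t i x.1 ∨ d.τ₀ ≤ x.1 0) ∧ R₀ ≤ r i x.1 ∧ r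 i x.1 ≤ R i (t i x.1)}) 0 (𝓢.deviationExtend (B i) (Ψ i)) ≤ ENNReal.ofReal (1 / (10 * ‖(Λ i : E4 →L[ℝ] E4)‖ ^ 2))) ∧ (∀ i (x : (B i).domain), (d.τ₀ ≤ t i x.1 ∨ d.τ₀ ≤ x.1 0) → R₀ ≤ r i x.1 → r i x.1 ≤ R i (t i x.1) → 𝓢.timeOrientation.IsFutureDirected (mfderiv 𝓘(ℝ, E4) (𝓡 4) (Ψ i) x ((Λ i) (E4.basisVector 0)))) ∧ (∀ i (y : E4) (hy : y ∈ (B i).domain), d.τ₀ ≤ y 0 → (∀ j, ρ j (y 0) < r j y) → r i y ≤ R i (t i y) + 1 → ∃ hy' : y ∈ d.flatDomain, Ψ i ⟨y, hy⟩ = Φ ⟨y, hy'⟩) ∧ (∀ y : d.flatDomain, d.τ₀ ≤ y.1 0 → ∀ j, ρ j (y.1 0) < r j y.1) ∧ (∀ j (y : E4), d.τ₀ ≤ y 0 → r j y ≤ ρ j (y 0) → r j y + 2 ≤ R j (t j y)) ∧ (∀ j (y : E4), d.τ₀ ≤ t j y → r j y ≤ R j (t j y) + 2 → t j y ≤ y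 0) ∧ (∀ j, Ψ j '' {x | d.τ₀ < t j x.1 ∧ R j (t j x.1) + 1 < r j x.1} ⊆ d.radiationZone) ∧ (∀ τ' : ℝ, d.τ₀ < τ' → closure (Φ '' {y | τ' ≤ y.1 0}) ⊆ Φ '' {y | τ' ≤ y.1 0} ∪ ⋃ j, Ψ j '' {x | τ' ≤ x.1 0 ∧ r j x.1 = ρ j (x.1 0)}) ∧ (∀ j j' (y : E4), j ≠ j' → (d.τ₀ ≤ y 0 ∨ d.τ₀ ≤ t j y) → r j y ≤ R j (t j y) + 1 → R j' (t j' y) + 1 < r j' y) )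
    ∃ (𝓢 : Spacetime.{0} 4) (O : Set 𝓢.carrier) (d : FinalStateDecomposition 𝓢 O 2)
      (R : Fin d.N → ℝ → ℝ) (R₀ : ℝ), d.N = 1 ∧
      O = 𝓢.metric.causalFuture 𝓢.timeOrientation univ ∩
        𝓢.metric.chronologicalPast 𝓢.timeOrientation d.charted ∧
      Hc 𝓢 O 2 d R₀ ∧ Sm 𝓢 O d R R₀ ∧ HasExhaustiveCharts d := by
  intro Hc Sm
  obtain ⟨P, hM, hr, htail⟩ := exists_params 2 two_pos le_rfl
  exact ⟨SchwModel.ST P, SchwModel.O P, SchwModel.decomp P, fun _ ↦ SchwModel.Rc P, P.R₀, rfl,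
    SchwModel.O_eq_core P (by rw [hr, hM]; norm_num), SchwModel.honestCore_decomp P,
    SchwModel.seamed_decomp P htail, SchwModel.hasExhaustiveCharts_decomp P⟩

/-- **The `∩ O` of the frontier statement is load-bearing.** The statement "under `HonestCore` (`Hc`,
verbatim) and `SEAMED` (`Sm`, verbatim), for every `τ₁ > τ₀` the closure of the certified late region
minus the region is causally below the certified slab" — the registered stub `stub_frontierBelowSlab` of
crux `stmt-FinalStateConjecture-13551` WITHOUT its intersection of the closure with `O` — is FALSE: exact
Schwarzschild of mass `1` on the horizon-penetrating patch `{r > 1}`, `O = {r > 2}`, identity charts; the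
future-horizon point `z = (2, 2, 0, 0)` is a limit of the certified tube points `(2, 2 + 1/(n+1), 0, 0)`,
is not charted (`r(z) = 2M`), and is not in `J⁻` of the certified slab at chart time `1`, which lies in
`{x⁰ = 1}` while `x⁰(z) = 2` and Kerr–Schild time is a time function (`KerrTime.time_le_of_mem_causalPast`).
Horizon-side limit points are exactly what `HonestCore` (c) is relativised to `O` for.
Dafermos–Rodnianski arXiv:0811.0354, §5.1; O'Neill 1983, Ch. 14, p. 403. [folklore] -/
theorem not_frontierBelowSlab_absolute :
    let Hc := ( fun (𝓢 : Spacetime.{0} 4) (O : Set 𝓢.carrier) (k : ℕ) (d : FinalStateDecomposition 𝓢 O k) (R₀ : ℝ) => let B := d.background; let t := fun i ↦ (B i).time; let r := fun i ↦ (B i).radius; let Ψ := d.chart; (∀ i, Kerr.IsSubextremal (d.mass i) (d.spin i) ∧ 100 * d.mass i ≤ R₀ ∧ 0 < ((d.motion i).1 : E4 ≃L[ℝ] E4) (E4.basisVector 0) 0) ∧ (∀ i (ϱ τ₂ : ℝ), R₀ ≤ ϱ → d.τ₀ < τ₂ → Ψ i '' {x | d.τ₀ < t i x.1 ∧ t i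 x.1 < τ₂ ∧ r i x.1 < ϱ} ⊆ 𝓢.metric.causalPast 𝓢.timeOrientation (Ψ i '' (B i).truncTimeSlab ϱ τ₂)) ∧ (∀ i (τ' : ℝ) (ϱ : ℝ → ℝ), Continuous ϱ → d.τ₀ < τ' → let A := Ψ i '' {x | τ' ≤ t i x.1 ∧ r i x.1 ≤ ϱ (t i x.1)}; closure A ∩ O ⊆ A) ∧ (∀ y : d.flatDomain, d.τ₀ < y.1 0 → 𝓢.timeOrientation.IsFutureDirected (mfderiv 𝓘(ℝ, E4) (𝓡 4) d.flatChart y (E4.basisVector 0))) )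
    let Sm := ( fun (𝓢 : Spacetime.{0} 4) (O : Set 𝓢.carrier) (d : FinalStateDecomposition 𝓢 O 2) (R : Fin d.N → ℝ → ℝ) (R₀ : ℝ) => let B := d.background; let t := fun i ↦ (B i).time; let r := fun i ↦ (B i).radius; let Λ := fun i ↦ ((d.motion i).1 : E4 ≃L[ℝ] E4); let Φ := d.flatChart; let Ψ := d.chart; let ρ := d.excision; (∀ i, Monotone (R i) ∧ Continuous (R i) ∧ ∀ s, R₀ + 4 ≤ R i s ∧ R₀ ≤ ρ i s) ∧ (∀ i, Tendsto (fun τ ↦ 𝓢.truncDeviationCk (B i) (Ψ i) 2 (R i τ) τ) atTop (𝓝 0)) ∧ supCkENorm (Subtype.val '' {y : d.flatDomain | d.τ₀ ≤ y.1 0}) 0 (𝓢.deviationExtend (Minkowski.backgroundOn d.flatDomain) Φ) ≤ 10⁻¹ ∧ (∀ i, supCkENorm (Subtype.val '' {x : (B i).domain | (d.τ₀ ≤ t i x.1 ∨ d.τ₀ ≤ x.1 0) ∧ R₀ ≤ r i x.1 ∧ r i x.1 ≤ R i (t i x.1)}) 0 (𝓢.deviationExtend (B i) (Ψ i)) ≤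 ENNReal.ofReal (1 / (10 * ‖(Λ i : E4 →L[ℝ] E4)‖ ^ 2))) ∧ (∀ i (x : (B i).domain), (d.τ₀ ≤ t i x.1 ∨ d.τ₀ ≤ x.1 0) → R₀ ≤ r i x.1 → r i x.1 ≤ R i (t i x.1) → 𝓢.timeOrientation.IsFutureDirected (mfderiv 𝓘(ℝ, E4) (𝓡 4) (Ψ i) x ((Λ i) (E4.basisVector 0)))) ∧ (∀ i (y : E4) (hy : y ∈ (B i).domain), d.τ₀ ≤ y 0 → (∀ j, ρ j (y 0) < r j y) → r i y ≤ R i (t i y) + 1 → ∃ hy' : y ∈ d.flatDomain, Ψ i ⟨y, hy⟩ = Φ ⟨y, hy'⟩) ∧ (∀ y : d.flatDomain, d.τ₀ ≤ y.1 0 → ∀ j, ρ j (y.1 0) < r j y.1) ∧ (∀ j (y : E4), d.τ₀ ≤ y 0 → r j y ≤ ρ j (y 0) → r j y + 2 ≤ R j (t j y)) ∧ (∀ j (y : E4), d.τ₀ ≤ t j y → r j y ≤ R j (t j y) + 2 → t j y ≤ y 0) ∧ (∀ j, Ψ j '' {x | d.τ₀ < t j x.1 ∧ R j (t j x.1) +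 1 < r j x.1} ⊆ d.radiationZone) ∧ (∀ τ' : ℝ, d.τ₀ < τ' → closure (Φ '' {y | τ' ≤ y.1 0}) ⊆ Φ '' {y | τ' ≤ y.1 0} ∪ ⋃ j, Ψ j '' {x | τ' ≤ x.1 0 ∧ r j x.1 = ρ j (x.1 0)}) ∧ (∀ j j' (y : E4), j ≠ j' → (d.τ₀ ≤ y 0 ∨ d.τ₀ ≤ t j y) → r j y ≤ R j (t j y) + 1 → R j' (t j' y) + 1 < r j' y) )
    ¬ ∀ (𝓢 : Spacetime.{0} 4) (O : Set 𝓢.carrier) (d : FinalStateDecomposition 𝓢 O 2)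
      (R : Fin d.N → ℝ → ℝ) (R₀ : ℝ), Hc 𝓢 O 2 d R₀ → Sm 𝓢 O d R R₀ →
      ∀ τ₁ : ℝ, d.τ₀ < τ₁ →
        closure (certifiedLate d R τ₁) \ certifiedLate d R τ₁ ⊆
          𝓢.metric.causalPast 𝓢.timeOrientation (certifiedSlab d R τ₁) := by
  intro Hc Sm h
  obtain ⟨P, hM, hr, htail⟩ := exists_params 1 one_pos (by norm_num)
  have hr₀ : P.r₀ < 2 * P.M := by rw [hr, hM]; norm_num
  have hz := h (SchwModel.ST P) (SchwModel.O P) (SchwModel.decomp P) (fun _ ↦ SchwModel.Rc P) P.R₀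
    (SchwModel.honestCore_decomp P) (SchwModel.seamed_decomp P htail) 1 one_pos
    (SchwModel.zH_mem_closure_diff P hr₀)
  exact SchwModel.zH_not_mem_causalPast_slab P hr₀ hz

/-- **`HonestCore` (c) must be relativised to `O`.** The absolute variant of clause (c) — "for every hole
`i`, every `τ' > τ₀` and every continuous radius profile `ϱ`, the image of the late tube portion
`{τ' ≤ t*ᵢ, rᵢ ≤ ϱ(t*ᵢ)}` is CLOSED" — is incompatible with `HonestCore` (`Hc`, verbatim) as soon as the
ambient spacetime contains the future event horizon: same model (`{r > 1}`, mass `1`), the horizon point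
`(2, 2, 0, 0)` lies in the closure of the late tube `{1 ≤ t*, r ≤ R₀ + 4 + √2}` of the identity hole chart
but has `r = 2M`, so it is not a chart point. Dafermos–Rodnianski arXiv:0811.0354, §5.1. [folklore] -/
theorem not_absolute_tubeClosedness :
    let Hc := ( fun (𝓢 : Spacetime.{0} 4) (O : Set 𝓢.carrier) (k : ℕ) (d : FinalStateDecomposition 𝓢 O k) (R₀ : ℝ) => let B := d.background; let t := fun i ↦ (B i).time; let r := fun i ↦ (B i).radius; let Ψ := d.chart; (∀ i, Kerr.IsSubextremal (d.mass i) (d.spin i) ∧ 100 * d.mass i ≤ R₀ ∧ 0 < ((d.motion i).1 : E4 ≃L[ℝ] E4) (E4.basisVector 0) 0) ∧ (∀ i (ϱ τ₂ : ℝ), R₀ ≤ ϱ → d.τ₀ < τ₂ → Ψ i '' {x | d.τ₀ < t i x.1 ∧ t i x.1 < τ₂ ∧ r i x.1 < ϱ} ⊆ 𝓢.metric.causalPast 𝓢.timeOrientation (Ψ i '' (B i).truncTimeSlab ϱ τ₂)) ∧ (∀ i (τ' : ℝ) (ϱ : ℝ → ℝ), Continuous ϱ → d.τ₀ < τ' →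 let A := Ψ i '' {x | τ' ≤ t i x.1 ∧ r i x.1 ≤ ϱ (t i x.1)}; closure A ∩ O ⊆ A) ∧ (∀ y : d.flatDomain, d.τ₀ < y.1 0 → 𝓢.timeOrientation.IsFutureDirected (mfderiv 𝓘(ℝ, E4) (𝓡 4) d.flatChart y (E4.basisVector 0))) )
    ¬ ∀ (𝓢 : Spacetime.{0} 4) (O : Set 𝓢.carrier) (k : ℕ) (d : FinalStateDecomposition 𝓢 O k)
      (R₀ : ℝ), Hc 𝓢 O k d R₀ →
      ∀ (i : Fin d.N) (τ' : ℝ) (ϱ : ℝ → ℝ), Continuous ϱ → d.τ₀ < τ' →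
        IsClosed (d.chart i '' {x | τ' ≤ (d.background i).time x.1 ∧
          (d.background i).radius x.1 ≤ ϱ ((d.background i).time x.1)}) := by
  intro Hc h
  obtain ⟨P, hM, hr, -⟩ := exists_params 1 one_pos (by norm_num)
  have hr₀ : P.r₀ < 2 * P.M := by rw [hr, hM]; norm_num
  have hc := h (SchwModel.ST P) (SchwModel.O P) 2 (SchwModel.decomp P) P.R₀
    (SchwModel.honestCore_decomp P) default 1 (fun _ ↦ SchwModel.Rc P 2) continuous_const one_pos
  have hz : SchwModel.zH P hr₀ ∈ closure ((SchwModel.decomp P).chart default ''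
      {x | 1 ≤ ((SchwModel.decomp P).background default).time x.1 ∧
        ((SchwModel.decomp P).background default).radius x.1 ≤
          (fun _ ↦ SchwModel.Rc P 2) (((SchwModel.decomp P).background default).time x.1)}) := by
    refine SchwModel.zH_mem_closure_image P hr₀ fun n ↦ ⟨?_, ?_⟩
    · show (1 : ℝ) ≤ (boostedKerrBackground 1 0 P.M 0).time (SchwModel.wn P n).1
      rw [SchwModel.bg_time, SchwModel.wn_zero]; norm_num
    · show (boostedKerrBackground 1 0 P.M 0).radius (SchwModel.wn P n).1 ≤ SchwModel.Rc P 2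
      rw [SchwModel.bg_radius]
      exact SchwModel.radius_wn_le P n
  rw [hc.closure_eq] at hz
  exact SchwModel.zH_not_mem_image_Ψ P hr₀ _ hz
end Summit.FinalStateConjecture.FinalStateConjecture.Theorems.SeamedChartsExhaust.Negative

end
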